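import Literature.AlgebraicGeometry.Frobenioids.PerfectionStandardTypes
import Literature.AnabelianGeometry.EtaleTheta.Discharge.Sec3RatFnMonoidOn
import Literature.AnabelianGeometry.EtaleTheta.BiKummerThm44SubBase

/-!
# [EtTh] Theorem 4.4 (i)/(iii) at the CANONICAL [FrdI] vocabulary: the standing hypotheses
# "`C_i` is a Frobenioid" and "`Φ_i` non-dilating" discharged — proof-only companion

S. Mochizuki, *The étale theta function …*, Publ. RIMS **45** (2009) [MochizukiEtTh2009], §4, Thm 4.4 (PDF
pp.93–95).  Sub-DAG `plan/L2/SUBDAG-EtTh-Thm44.md` (holder abc-iut-w5-d179), residual (α) of v3.1: {"`C_i` is a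
[tempered] Frobenioid" ([FrdI] Thm 5.2 (ii) / Def 3.6 (ii)), `Remark372` (Rmk 3.7.2), "`Φ_i` non-dilating"}.  When
the §4 settings live over the canonical vocabularies (`treeMonoidVocab`, `treeCatVocab` — the case of every
construction in the tree), two of the three are theorems:
* "`Φ_i` non-dilating" in [FrdI] language IS the field `Thm44Hyp.isNonDilating_i` (`treeMonoidVocab.IsNonDilating`
  is the tree's `IsNonDilating`): `Thm44Hyp.isNonDilatingOn_ofFunctor₁/₂`;
* "`C_i` is a Frobenioid" is abc-iut-L2-t3's `TemperedFrobenioid.isFrobenioid_of_structural` (Def 3.6 (ii) via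
  [FrdI] Thm 5.2 (ii), `Discharge/Sec3RatFnMonoidOn`) modulo `hBinj` (pull-backs of the Def 3.3 (iii) datum
  `B₀^Λ` injective) and `hFSM` (FSM-morphisms of `D_i` are isomorphisms) — and `hFSM` is `Remark372` through
  `Thm44Hyp.isOfFSMType_base_i` (`BiKummerThm44SubBase`): `Thm44Hyp.isFrobenioid₁/₂`.
Net (`thm44_i_treeVocab`, `thm44_iii_treeVocab`): **Thm 4.4 (i) ⇐ {`Remark372 D₀`, `Remark372 D₀'`, `hBinj₁`,
`hBinj₂`, T44-L09c, T44-L09}**, **Thm 4.4 (iii) (v5) ⇐ {the same four, T44-L15b}** — the named fact of Rmk 3.7.2,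
one injectivity property of the Def 3.3 (iii) input data per side, and the [SemiAnbd] / [FrdII] input rows over
the free `galoisSurj` / `IsNHSaturatedBsFld` fields.
HONEST FRAMING: refereed pre-IUT material; nothing here bears on [IUTchIII] Cor. 3.12; typed ≠ proved.
-/

namespace Literature.AnabelianGeometry.EtaleTheta

open CategoryTheory Opposite Literature.AlgebraicGeometry.Frobenioids Function

namespace BiKummerSetting

universe u₀ v₀ u v w

variable {K : Type u₀} [Field K] {K' : Type u₀} [Field K'] {D₀ : Type u₀} [Category.{v₀} D₀]
  {X₁ : SemiGraphs.TemperedArithmeticGroup.{u₀} K} {X₂ : SemiGraphs.TemperedArithmeticGroup.{u₀} K'}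
  {D₀' : Type u₀} [Category.{v₀} D₀']
  {T₁ : RealifiedDivisorMonoids (D₀ := D₀) treeMonoidVocab.{w}}
  {T₂ : RealifiedDivisorMonoids (D₀ := D₀') treeMonoidVocab.{w}}
  {D₁ D₂ : Type u} [Category.{v} D₁] [Category.{v} D₂]
  {IsRational₁ IsStrictlyRational₁ : (D₁ᵒᵖ ⥤ CommMonCat.{w}) → Prop}
  {IsRational₂ IsStrictlyRational₂ : (D₂ᵒᵖ ⥤ CommMonCat.{w}) → Prop}
  {S₁ : BiKummerSetting X₁ T₁ D₁ (treeCatVocab D₁ IsRational₁ IsStrictlyRational₁)}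
  {S₂ : BiKummerSetting X₂ T₂ D₂ (treeCatVocab D₂ IsRational₂ IsStrictlyRational₂)}

/-- At the canonical monoid vocabulary, "`Φ₁` non-dilating" (field `Thm44Hyp.isNonDilating₁`) is the [FrdI]
Def 1.1 (ii) property of the pre-Frobenioid structure `C₁ → F_{Φ₁}`. [cite: MochizukiEtTh2009, Thm 4.4 p.93] -/
theorem Thm44Hyp.isNonDilatingOn_ofFunctor₁ (h : Thm44Hyp S₁ S₂) :
    (PreFrobenioidData.ofFunctor S₁.tf.divisorMonoid S₁.F).IsNonDilatingOn :=
  ⟨fun X f => (PreFrobenioidData.isNonDilating_iff_isNonDilating _).mpr (h.isNonDilating₁ (op X) f.op)⟩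

/-- At the canonical monoid vocabulary, "`Φ₂` non-dilating" (field `Thm44Hyp.isNonDilating₂`) is the [FrdI]
Def 1.1 (ii) property of `C₂ → F_{Φ₂}`. [cite: MochizukiEtTh2009, Thm 4.4 p.93] -/
theorem Thm44Hyp.isNonDilatingOn_ofFunctor₂ (h : Thm44Hyp S₁ S₂) :
    (PreFrobenioidData.ofFunctor S₂.tf.divisorMonoid S₂.F).IsNonDilatingOn :=
  ⟨fun X f => (PreFrobenioidData.isNonDilating_iff_isNonDilating _).mpr (h.isNonDilating₂ (op X) f.op)⟩

/-- **"`C₁` is a Frobenioid"** (Def 3.6 (ii) / [FrdI] Thm 5.2 (ii)) at the canonical vocabulary, from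
abc-iut-L2-t3's `isFrobenioid_of_structural`, with its `hFSM` input supplied by Rmk 3.7.2 through
`Thm44Hyp.isOfFSMType_base₁`; residual: `hBinj₁` (pull-backs of `B₀^Λ` injective, Def 3.3 (iii)).
[cite: MochizukiEtTh2009, Def 3.6 p.77] -/
theorem Thm44Hyp.isFrobenioid₁ (h : Thm44Hyp S₁ S₂) (h372 : TemperedFrobenioid.Remark372 D₀)
    (hBinj₁ : ∀ {Y Y' : D₀ᵒᵖ} (g : Y ⟶ Y'), Injective (T₁.BΛ.map g).hom) :
    PreFrobenioid.IsFrobenioid S₁.F :=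
  S₁.tf.isFrobenioid_of_structural hBinj₁ fun α hα => (h.isOfFSMType_base₁ h372.2.1).isIso_of_isFSM α hα

/-- **"`C₂` is a Frobenioid"** at the canonical vocabulary, likewise (residual `hBinj₂`).
[cite: MochizukiEtTh2009, Def 3.6 p.77] -/
theorem Thm44Hyp.isFrobenioid₂ (h : Thm44Hyp S₁ S₂) (h372' : TemperedFrobenioid.Remark372 D₀')
    (hBinj₂ : ∀ {Y Y' : D₀'ᵒᵖ} (g : Y ⟶ Y'), Injective (T₂.BΛ.map g).hom) :
    PreFrobenioid.IsFrobenioid S₂.F :=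
  S₂.tf.isFrobenioid_of_structural hBinj₂ fun α hα => (h.isOfFSMType_base₂ h372'.2.1).isIso_of_isFSM α hα

/-- **Thm 4.4 (i) at the canonical vocabulary**: `Thm44_i h` ⇐ {`Remark372 D₀`, `Remark372 D₀'` (Rmk 3.7.2),
`hBinj₁`, `hBinj₂` (Def 3.3 (iii) data), T44-L09c + T44-L09 ([SemiAnbd] Prop 3.2 / Thm A.4 over the free
`galoisSurj`)}. [cite: MochizukiEtTh2009, Thm 4.4 p.94] -/
theorem Thm44Hyp.thm44_i_treeVocab (h : Thm44Hyp S₁ S₂)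
    (h372 : TemperedFrobenioid.Remark372 D₀) (h372' : TemperedFrobenioid.Remark372 D₀')
    (hBinj₁ : ∀ {Y Y' : D₀ᵒᵖ} (g : Y ⟶ Y'), Injective (T₁.BΛ.map g).hom)
    (hBinj₂ : ∀ {Y Y' : D₀'ᵒᵖ} (g : Y ⟶ Y'), Injective (T₂.BΛ.map g).hom)
    (h9c : h.GaloisCompatible) (h9 : h.HodotCompatible) : Thm44_i h :=
  h.thm44_i_of_remark372 (h.isFrobenioid₁ h372 hBinj₁) (h.isFrobenioid₂ h372' hBinj₂) h372 h372'
    h.isNonDilatingOn_ofFunctor₁ h.isNonDilatingOn_ofFunctor₂ h9c h9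

/-- **Thm 4.4 (iii) (saturation clause, v5) at the canonical vocabulary**: `Thm44_iii h ψ` ⇐ {`Remark372 D₀ /
D₀'`, `hBinj₁`, `hBinj₂`, T44-L15b ([FrdII] Def 2.2 (ii) / [AbsAnab] Lem 1.3.8 over the free
`IsNHSaturatedBsFld`)}. [cite: MochizukiEtTh2009, Thm 4.4 p.94] -/
theorem Thm44Hyp.thm44_iii_treeVocab (h : Thm44Hyp S₁ S₂)
    (ψ : ∀ A : S₁.C, S₁.biratUnits A ≃* S₂.biratUnits (h.Ψ.functor.obj A))
    (h372 : TemperedFrobenioid.Remark372 D₀) (h372' : TemperedFrobenioid.Remark372 D₀')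
    (hBinj₁ : ∀ {Y Y' : D₀ᵒᵖ} (g : Y ⟶ Y'), Injective (T₁.BΛ.map g).hom)
    (hBinj₂ : ∀ {Y Y' : D₀'ᵒᵖ} (g : Y ⟶ Y'), Injective (T₂.BΛ.map g).hom)
    (h15 : h.PreservesNHSaturatedBsFld) : Thm44_iii h ψ :=
  h.thm44_iii_of_remark372 ψ (h.isFrobenioid₁ h372 hBinj₁) (h.isFrobenioid₂ h372' hBinj₂) h372 h372'
    h.isNonDilatingOn_ofFunctor₁ h.isNonDilatingOn_ofFunctor₂ h15

end BiKummerSetting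

end Literature.AnabelianGeometry.EtaleTheta
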